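import Literature.Probability.RandomPlanarGeometry.UnbasedLoopSpace
import Literature.Probability.RandomPlanarGeometry.LoopSpaceMaps
import HarnessLib

/-!
# Typed loop configurations and DKKMO's Camia–Newman-type distance `d_CN`

Third step (after `UnbasedLoops`, `UnbasedLoopSpace`) of the paper-form ("as printed") objects of
Duminil-Copin–Kozlowski–Krachun–Manolescu–Oulamara, *Rotational invariance in critical planar
lattice models*, arXiv:2012.11672v2 (2026), §1.2, used to state their Theorems 1.2/1.7/1.9
literally (layer N1 of the decomposition of the named fact `dkkmo_rotation_invariance`,
crit-perc.S25).

DKKMO (§1.2, p. 4–5): "Let `C` be the collection of sets `F = F₀ ⊔ F₁` of two locally finite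
families `F₀` and `F₁` of non-self-crossing loops [...] that do not intersect each other. Define
the metric on `C`,
`d_CN(F, F') ≤ ε ⟺ ∀ i ∈ {0, 1}, ∀ γ ∈ F_i with γ ⊂ B(0, 1/ε), ∃ γ' ∈ F'_i, d(γ, γ') ≤ ε, and
similarly when exchanging F' and F`, where, for two loops `γ₁` and `γ₂`, we set
`d(γ₁, γ₂) := inf sup_{t ∈ S¹} |γ₁(t) − γ₂(t)|` (1), with the infimum running over all
continuous one-to-one parametrizations of the loops `γ₁` and `γ₂` by `S¹`."  And (eq. (2)):
"`d_CN(φ, φ') := inf {ε so that ∃ coupling P of φ and φ' with P[d_CN(ω, ω') > ε] < ε}`."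

## Contents

* `Curve.reverse_shift`, `Curve.loopDist_reverse_reverse`: time reversal is an isometry of the
  unbased oriented distance; `BasedLoop.reverse`, `UnbasedLoop.reverse` (an isometric involution
  of the space of unbased oriented loops), `UnbasedLoop.range_reverse`.
* `UnbasedLoop.udist u v := min (dist u v) (dist u v.reverse)` — **the printed `d` of eq. (1)**:
  the infimum over *all* one-to-one parametrisations by the circle, orientation-preserving
  (`dist`, i.e. `loopDist`) or orientation-reversing (`dist u v.reverse`). A pseudo-metric on
  `UnbasedLoop E` whose zero set is `{v = u} ∪ {v = u.reverse}` (`udist_eq_zero_iff`); it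
  dominates the Hausdorff distance of the traces (`hausdorffDist_range_le_udist`).
* `LoopConfig E` — DKKMO's typed configurations `F = F₀ ⊔ F₁` (two families of unbased loops,
  indexed by `Fin 2`; the regularity conditions — local finiteness, no crossings — are not part of
  the type), `LoopConfig.IsClose ε F F'` — **the printed relation `d_CN(F, F') ≤ ε`** (display
  before eq. (1)), its symmetry, monotonicity in `ε`, reflexivity and restricted transitivity
  (`IsClose.trans`, for `ε + ε' ≤ 1`: the soft window `B(0, 1/ε)` makes `d_CN` sub-additive only
  at small scales), and `LoopConfig.cnEDist F F' := inf {ε > 0 : IsClose ε F F'}` in `[0, ∞]`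
  with `cnEDist_le_iff_forall_lt : cnEDist F F' ≤ r ↔ ∀ ε > r, IsClose ε F F'` (`r` finite).
* `LoopConfig.cnLawEDist` — **the printed coupling distance of eq. (2)** between the laws of two
  random configurations `X : Ω → LoopConfig E`, `X' : Ω' → LoopConfig E` under `μ`, `μ'`, with the
  couplings realised as measures on `Ω × Ω'` with marginals `μ`, `μ'` (this is how DKKMO phrase
  and build their couplings: "`ω ∼ φ_{δ𝕃(β)}` and `ω' ∼ φ_{δ𝕃(α)}` may be coupled so that the
  loop representations [...] are close", remark after Theorem 1.9; it also avoids putting a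
  σ-algebra on `C`, the exceptional set being measured by the outer measure), and
  `cnLawEDist_le_iff_forall_lt`: `cnLawEDist ≤ r ↔ ∀ ε > r, ∃ coupling P, P[¬ IsClose ε] < ε`.

## References

* H. Duminil-Copin, K. K. Kozlowski, D. Krachun, I. Manolescu, M. Oulamara, arXiv:2012.11672v2
  (2026), §1.2: the space `C`, the display defining `d_CN ≤ ε`, eq. (1), eq. (2).
* F. Camia, C. M. Newman, Comm. Math. Phys. 268 (2006), §2.2 (the based distance, for contrast).
* M. Aizenman, A. Burchard, Duke Math. J. 99 (1999), §2.1 (curves modulo reparametrisation).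
-/

noncomputable section

open Set MeasureTheory
open scoped unitInterval ENNReal

namespace Literature.Probability.RandomPlanarGeometry

/-! ### Time reversal and the unbased distance -/

namespace Curve

section Topological

variable {E : Type*} [TopologicalSpace E]

/-- A curve is a loop iff its time reversal is. [folklore] -/
theorem isLoop_reverse_iff (γ : Curve E) : γ.reverse.IsLoop ↔ γ.IsLoop := by
  rw [Curve.isLoop_iff, Curve.isLoop_iff, source_reverse, target_reverse, eq_comm]

/-- Time reversal turns a change of base point by `b` into one by `-b`:
`(γ.shift b).reverse = γ.reverse.shift (-b)`. [folklore] -/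
theorem reverse_shift (γ : Curve E) (b : ℝ) : (γ.shift b).reverse = γ.reverse.shift (-b) := by
  by_cases hγ : γ.IsLoop
  · have hγ' : γ.reverse.IsLoop := (isLoop_reverse_iff γ).2 hγ
    apply DFunLike.coe_injective
    funext t
    rw [reverse_apply, shift_apply hγ, shift_apply hγ', loopMap_coe_eq, loopMap_coe_eq,
      reverse_apply]
    apply apply_eq_of_fract_eq hγ
    simp only [unitInterval.coe_symm_eq, Int.fract_fract]
    rw [Int.fract_eq_fract]
    refine ⟨-⌊(t : ℝ) + -b⌋, ?_⟩
    rw [Int.cast_neg, ← Int.self_sub_floor]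
    ring
  · rw [shift_of_not_isLoop hγ, shift_of_not_isLoop (mt (isLoop_reverse_iff γ).1 hγ)]

end Topological

section Metric

variable {E : Type*} [PseudoMetricSpace E]

/-- Time reversal does not decrease the unbased oriented distance. [folklore] -/
theorem loopDist_le_loopDist_reverse_reverse (α β : Curve E) :
    loopDist α β ≤ loopDist α.reverse β.reverse := by
  refine le_ciInf fun b ↦ ?_
  have h : β.reverse.shift (b : ℝ) = (β.shift (-(b : ℝ))).reverse := by
    rw [reverse_shift, neg_neg]
  rw [h, ← dist_def, dist_reverse_reverse, dist_def]
  exact loopDist_le' α β _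

/-- **Time reversal is an isometry of the unbased oriented distance**:
`loopDist α.reverse β.reverse = loopDist α β`. [folklore] -/
@[simp] theorem loopDist_reverse_reverse (α β : Curve E) :
    loopDist α.reverse β.reverse = loopDist α β := by
  refine le_antisymm ?_ (loopDist_le_loopDist_reverse_reverse α β)
  simpa using loopDist_le_loopDist_reverse_reverse α.reverse β.reverse

end Metric

end Curve

namespace CurveClass

variable {E : Type*} [MetricSpace E]

/-- A curve class is a loop iff its time reversal is. [folklore] -/
theorem isLoop_reverse_iff (c : CurveClass E) : c.reverse.IsLoop ↔ c.IsLoop := by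
  obtain ⟨γ, rfl⟩ := surjective_mk c
  rw [reverse_mk, isLoop_mk, isLoop_mk, Curve.isLoop_reverse_iff]

/-- Time reversal is an isometry of `CurveClass.loopDist`. [folklore] -/
@[simp] theorem loopDist_reverse_reverse (c₁ c₂ : CurveClass E) :
    loopDist c₁.reverse c₂.reverse = loopDist c₁ c₂ := by
  obtain ⟨α, rfl⟩ := surjective_mk c₁
  obtain ⟨β, rfl⟩ := surjective_mk c₂
  simp

end CurveClass

namespace BasedLoop

variable {E : Type*} [MetricSpace E]

/-- Time reversal of a based loop. [folklore] -/
def reverse (ℓ : BasedLoop E) : BasedLoop E :=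
  mk ℓ.toCurveClass.reverse ((CurveClass.isLoop_reverse_iff _).2 ℓ.isLoop)

/-- The class of the reversed based loop. [folklore] -/
@[simp] theorem toCurveClass_reverse (ℓ : BasedLoop E) :
    ℓ.reverse.toCurveClass = ℓ.toCurveClass.reverse := rfl

/-- Time reversal of based loops is an involution. [folklore] -/
@[simp] theorem reverse_reverse (ℓ : BasedLoop E) : ℓ.reverse.reverse = ℓ :=
  Subtype.ext (CurveClass.reverse_reverse _)

/-- Time reversal of based loops is an isometry of the unbased distance. [folklore] -/
@[simp] theorem dist_reverse_reverse (ℓ ℓ' : BasedLoop E) :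
    dist ℓ.reverse ℓ'.reverse = dist ℓ ℓ' :=
  CurveClass.loopDist_reverse_reverse _ _

/-- Time reversal of based loops is an isometry. [folklore] -/
theorem isometry_reverse : Isometry (reverse : BasedLoop E → BasedLoop E) :=
  Isometry.of_dist_eq dist_reverse_reverse

end BasedLoop

namespace UnbasedLoop

variable {E : Type*} [MetricSpace E]

/-- **Time reversal of unbased loops** (well defined: reversal is an isometry of the unbased
distance). [folklore] -/
def reverse : UnbasedLoop E → UnbasedLoop E :=
  SeparationQuotient.lift (mk ∘ BasedLoop.reverse) fun a b h ↦ by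
    simp only [Function.comp_apply, mk_eq_mk, BasedLoop.dist_reverse_reverse]
    exact Metric.inseparable_iff.1 h

/-- `reverse` on the unbased loop of a based loop. [folklore] -/
@[simp] theorem reverse_mk (ℓ : BasedLoop E) : (mk ℓ).reverse = mk ℓ.reverse := rfl

/-- Time reversal of unbased loops is an involution. [folklore] -/
@[simp] theorem reverse_reverse (u : UnbasedLoop E) : u.reverse.reverse = u := by
  obtain ⟨ℓ, rfl⟩ := mk_surjective u
  simp

/-- Time reversal of unbased loops is an isometry. [folklore] -/
@[simp] theorem dist_reverse_reverse (u v : UnbasedLoop E) :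
    dist u.reverse v.reverse = dist u v := by
  obtain ⟨ℓ, rfl⟩ := mk_surjective u
  obtain ⟨ℓ', rfl⟩ := mk_surjective v
  simp

/-- Moving the reversal to the other argument. [folklore] -/
theorem dist_reverse_left (u v : UnbasedLoop E) : dist u.reverse v = dist u v.reverse := by
  rw [← dist_reverse_reverse u.reverse v, reverse_reverse]

/-- Time reversal does not change the trace. [folklore] -/
@[simp] theorem range_reverse (u : UnbasedLoop E) : u.reverse.range = u.range := by
  obtain ⟨ℓ, rfl⟩ := mk_surjective u
  simp

/-! ### The printed loop distance `d` of DKKMO eq. (1) (unbased, unoriented) -/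

/-- **DKKMO's loop distance `d(γ₁, γ₂)`** (arXiv:2012.11672v2, eq. (1)): the infimum of
`sup_{t ∈ S¹} |γ₁(t) − γ₂(t)|` over *all* continuous one-to-one parametrisations of the two loops
by the circle. Splitting according to whether the two parametrisations induce the same or
opposite orientations, this is the minimum of the unbased oriented distance `dist u v`
(`Curve.loopDist`: orientation-preserving circle homeomorphisms, `Curve.reparam_shift`) and of
`dist u v.reverse`. [cite: arXiv201211672v2, eq. (1)] -/
def udist (u v : UnbasedLoop E) : ℝ := min (dist u v) (dist u v.reverse)

/-- Unfolding `udist`. [cite: arXiv201211672v2, eq. (1)] -/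
theorem udist_def (u v : UnbasedLoop E) : udist u v = min (dist u v) (dist u v.reverse) := rfl

/-- `d ≤` the oriented unbased distance. [folklore] -/
theorem udist_le_dist (u v : UnbasedLoop E) : udist u v ≤ dist u v := min_le_left _ _

/-- `d ≤` the unbased distance to the reversed loop. [folklore] -/
theorem udist_le_dist_reverse (u v : UnbasedLoop E) : udist u v ≤ dist u v.reverse :=
  min_le_right _ _

/-- `d` is nonnegative. [folklore] -/
theorem udist_nonneg (u v : UnbasedLoop E) : 0 ≤ udist u v := le_min dist_nonneg dist_nonneg

/-- `d(u, u) = 0`. [folklore] -/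
@[simp] theorem udist_self (u : UnbasedLoop E) : udist u u = 0 :=
  le_antisymm ((udist_le_dist u u).trans_eq (dist_self u)) (udist_nonneg u u)

/-- `d` is symmetric. [folklore] -/
theorem udist_comm (u v : UnbasedLoop E) : udist u v = udist v u := by
  rw [udist, udist, dist_comm u v, ← dist_reverse_left, dist_comm u.reverse v]

/-- `d` does not see the orientation of its arguments. [folklore] -/
@[simp] theorem udist_reverse_right (u v : UnbasedLoop E) : udist u v.reverse = udist u v := by
  rw [udist, udist, reverse_reverse, min_comm]

/-- `d` does not see the orientation of its arguments. [folklore] -/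
@[simp] theorem udist_reverse_left (u v : UnbasedLoop E) : udist u.reverse v = udist u v := by
  rw [udist_comm, udist_reverse_right, udist_comm]

/-- For a fixed orientation `v'` of the middle loop, `d(u, w) ≤ dist u v' + d(v', w)`. [folklore] -/
theorem udist_le_dist_add_udist (u v' w : UnbasedLoop E) :
    udist u w ≤ dist u v' + udist v' w := by
  rcases min_cases (dist v' w) (dist v' w.reverse) with ⟨h, -⟩ | ⟨h, -⟩ <;> rw [udist_def v' w, h]
  · exact (udist_le_dist u w).trans (dist_triangle u v' w)
  · exact (udist_le_dist_reverse u w).trans (dist_triangle u v' w.reverse)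

/-- Triangle inequality for `d`. [folklore] -/
theorem udist_triangle (u v w : UnbasedLoop E) : udist u w ≤ udist u v + udist v w := by
  rcases min_cases (dist u v) (dist u v.reverse) with ⟨h, -⟩ | ⟨h, -⟩ <;> rw [udist_def u v, h]
  · exact udist_le_dist_add_udist u v w
  · rw [← udist_reverse_left v w]
    exact udist_le_dist_add_udist u v.reverse w

/-- `d(u, v) = 0` iff `v` is `u` or its reversal: `d` is the quotient pseudo-metric of the
isometric involution `reverse`, i.e. the metric of *unoriented* unbased loops. [folklore] -/
theorem udist_eq_zero_iff {u v : UnbasedLoop E} : udist u v = 0 ↔ v = u ∨ v = u.reverse := by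
  constructor
  · intro h
    rcases min_cases (dist u v) (dist u v.reverse) with ⟨h', -⟩ | ⟨h', -⟩
    · rw [udist, h'] at h
      exact Or.inl (dist_eq_zero.1 h).symm
    · rw [udist, h'] at h
      right
      rw [← reverse_reverse v, ← (dist_eq_zero.1 h)]
  · rintro (rfl | rfl)
    · exact udist_self _
    · rw [udist_reverse_right, udist_self]

/-- The trace distance is dominated by `d`: traces of loops at `d`-distance `r` are at Hausdorff
distance `≤ r`. [folklore] -/
theorem hausdorffDist_range_le_udist (u v : UnbasedLoop E) :
    Metric.hausdorffDist u.range v.range ≤ udist u v := by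
  rcases min_cases (dist u v) (dist u v.reverse) with ⟨h, -⟩ | ⟨h, -⟩ <;> rw [udist, h]
  · exact hausdorffDist_range_le_dist u v
  · simpa using hausdorffDist_range_le_dist u v.reverse

/-- Every point of the trace of `u` is within `d(u, v)` of the trace of `v`. [folklore] -/
theorem infDist_range_le_udist (u v : UnbasedLoop E) {x : E} (hx : x ∈ u.range) :
    Metric.infDist x v.range ≤ udist u v := by
  rcases min_cases (dist u v) (dist u v.reverse) with ⟨h, -⟩ | ⟨h, -⟩ <;> rw [udist, h]
  · exact infDist_range_le_dist u v hx
  · simpa using infDist_range_le_dist u v.reverse hx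

/-- A point of the trace of `u` has a point of the trace of `v` within `d(u, v)`. [folklore] -/
theorem exists_mem_range_dist_le (u v : UnbasedLoop E) {x : E} (hx : x ∈ u.range) :
    ∃ y ∈ v.range, dist x y ≤ udist u v := by
  obtain ⟨y, hy, hxy⟩ := v.isCompact_range.exists_infDist_eq_dist v.range_nonempty x
  exact ⟨y, hy, hxy ▸ infDist_range_le_udist u v hx⟩

end UnbasedLoop

/-! ### Typed loop configurations and the relation `d_CN(F, F') ≤ ε` -/

/-- **DKKMO's space `C` of typed loop configurations** (arXiv:2012.11672v2, §1.2): a pair of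
families of (unbased, unoriented-compared) loops, `F 0` = `F₀` ("exterior boundaries of dual
clusters") and `F 1` = `F₁` ("exterior boundaries of primal clusters"). The regularity conditions
of the paper (local finiteness, loops non-self-crossing and mutually non-intersecting) are
properties of the percolation configurations, not part of the type; the distance below makes
sense without them. Loops are entered as unbased *oriented* loops (`UnbasedLoop E`), but are only
ever compared through the unoriented distance `UnbasedLoop.udist` (DKKMO's `d`, eq. (1)), so the
orientation of a member is immaterial (`IsClose.of_forall_mem_or_reverse_mem`). [cite: arXiv201211672v2, §1.2] -/
@[ext]
structure LoopConfig (E : Type*) [MetricSpace E] where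
  /-- The two families `F₀`, `F₁`, indexed by the type `i ∈ {0, 1}`. -/
  F : Fin 2 → Set (UnbasedLoop E)

namespace LoopConfig

variable {E : Type*} [NormedAddCommGroup E]

/-- **The printed relation `d_CN(F, F') ≤ ε`** (DKKMO, arXiv:2012.11672v2, §1.2, display before
eq. (1)): "`∀ i ∈ {0, 1}, ∀ γ ∈ F_i with γ ⊂ B(0, 1/ε), ∃ γ' ∈ F'_i, d(γ, γ') ≤ ε`, and similarly
when exchanging `F'` and `F`" — every loop of either configuration lying in the window
`B(0, 1/ε)` (open ball) has an `ε`-close loop *of the same type* in the other configuration,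
closeness being measured by the unbased unoriented distance `d = UnbasedLoop.udist` of eq. (1). [cite: arXiv201211672v2, §1.2] -/
def IsClose (ε : ℝ) (c c' : LoopConfig E) : Prop :=
  ∀ i : Fin 2,
    (∀ u ∈ c.F i, u.range ⊆ Metric.ball (0 : E) (1 / ε) → ∃ u' ∈ c'.F i, u.udist u' ≤ ε) ∧
    (∀ u' ∈ c'.F i, u'.range ⊆ Metric.ball (0 : E) (1 / ε) → ∃ u ∈ c.F i, u'.udist u ≤ ε)

/-- `d_CN(F, F') ≤ ε` is symmetric in `F, F'` ("and similarly when exchanging `F'` and `F`"). [cite: arXiv201211672v2, §1.2] -/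
theorem IsClose.symm {ε : ℝ} {c c' : LoopConfig E} (h : IsClose ε c c') : IsClose ε c' c :=
  fun i ↦ ⟨(h i).2, (h i).1⟩

/-- `d_CN(F, F') ≤ ε` is symmetric. [cite: arXiv201211672v2, §1.2] -/
theorem isClose_comm {ε : ℝ} {c c' : LoopConfig E} : IsClose ε c c' ↔ IsClose ε c' c :=
  ⟨IsClose.symm, IsClose.symm⟩

/-- `d_CN(F, F) ≤ ε` for every `ε ≥ 0`. [folklore] -/
theorem isClose_self {ε : ℝ} (hε : 0 ≤ ε) (c : LoopConfig E) : IsClose ε c c :=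
  fun i ↦ ⟨fun u hu _ ↦ ⟨u, hu, by rwa [UnbasedLoop.udist_self]⟩,
    fun u hu _ ↦ ⟨u, hu, by rwa [UnbasedLoop.udist_self]⟩⟩

/-- Monotonicity: for `0 < ε ≤ ε'`, `d_CN ≤ ε` implies `d_CN ≤ ε'` (the window `B(0, 1/ε)`
shrinks and the tolerance grows), so that `{ε > 0 : d_CN(F, F') ≤ ε}` is an up-set and the
display indeed defines `d_CN` as its infimum (`cnEDist`). [cite: arXiv201211672v2, §1.2] -/
theorem IsClose.mono {ε ε' : ℝ} (hε : 0 < ε) (hle : ε ≤ ε') {c c' : LoopConfig E}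
    (h : IsClose ε c c') : IsClose ε' c c' := by
  have hball : Metric.ball (0 : E) (1 / ε') ⊆ Metric.ball 0 (1 / ε) :=
    Metric.ball_subset_ball (one_div_le_one_div_of_le hε hle)
  intro i
  refine ⟨fun u hu hr ↦ ?_, fun u' hu' hr ↦ ?_⟩
  · obtain ⟨u', hu', hd⟩ := (h i).1 u hu (hr.trans hball)
    exact ⟨u', hu', hd.trans hle⟩
  · obtain ⟨u, hu, hd⟩ := (h i).2 u' hu' (hr.trans hball)
    exact ⟨u, hu, hd.trans hle⟩

/-- Reversing members does not affect closeness (only the unoriented distance `d` is used): if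
every member of `c₁` is a member of `c` up to orientation and conversely, then `c₁` is as close
to `c'` as `c` is. [folklore] -/
theorem IsClose.of_forall_mem_or_reverse_mem {ε : ℝ} {c c₁ c' : LoopConfig E}
    (h : IsClose ε c c') (h₁ : ∀ i, ∀ u ∈ c₁.F i, u ∈ c.F i ∨ u.reverse ∈ c.F i)
    (h₂ : ∀ i, ∀ u ∈ c.F i, u ∈ c₁.F i ∨ u.reverse ∈ c₁.F i) : IsClose ε c₁ c' := by
  intro i
  refine ⟨fun u hu hr ↦ ?_, fun u' hu' hr ↦ ?_⟩
  · rcases h₁ i u hu with hu₀ | hu₀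
    · exact (h i).1 u hu₀ hr
    · obtain ⟨u', hu', hd⟩ := (h i).1 u.reverse hu₀ (by rwa [UnbasedLoop.range_reverse])
      exact ⟨u', hu', by rwa [UnbasedLoop.udist_reverse_left] at hd⟩
  · obtain ⟨u, hu, hd⟩ := (h i).2 u' hu' hr
    rcases h₂ i u hu with hu₁ | hu₁
    · exact ⟨u, hu₁, hd⟩
    · exact ⟨u.reverse, hu₁, by rwa [UnbasedLoop.udist_reverse_right]⟩

/-- A loop `ε`-close (in `d`) to a loop inside `B(0, r)` lies inside `B(0, r + ε)`. [folklore] -/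
theorem _root_.Literature.Probability.RandomPlanarGeometry.UnbasedLoop.range_subset_ball_of_udist_le {u u' : UnbasedLoop E} {r ε : ℝ}
    (hr : u.range ⊆ Metric.ball (0 : E) r) (hd : u.udist u' ≤ ε) :
    u'.range ⊆ Metric.ball (0 : E) (r + ε) := by
  intro x hx
  obtain ⟨y, hy, hxy⟩ := UnbasedLoop.exists_mem_range_dist_le u' u hx
  rw [UnbasedLoop.udist_comm] at hxy
  have hy' := hr hy
  rw [Metric.mem_ball, dist_zero_right] at hy' ⊢
  calc ‖x‖ = ‖y + (x - y)‖ := by rw [add_sub_cancel]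
    _ ≤ ‖y‖ + ‖x - y‖ := norm_add_le _ _
    _ < r + ε := add_lt_add_of_lt_of_le hy' (by rw [← dist_eq_norm]; exact hxy.trans hd)

/-- **Restricted triangle inequality for `d_CN`.** If `d_CN(F, F') ≤ ε`, `d_CN(F', F'') ≤ ε'` and
`ε + ε' ≤ 1`, then `d_CN(F, F'') ≤ ε + ε'`: a loop of `F` inside `B(0, 1/(ε + ε'))` has an
`ε`-close partner in `F'`, which lies inside `B(0, 1/(ε + ε') + ε) ⊆ B(0, 1/ε')` *because*
`ε' (ε + ε') ≤ 1`, hence has an `ε'`-close partner in `F''`. Without a smallness condition the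
soft window `B(0, 1/ε)` breaks sub-additivity (DKKMO call `d_CN` a metric; only small distances
matter). [cite: arXiv201211672v2, §1.2] -/
theorem IsClose.trans {ε ε' : ℝ} (hε : 0 < ε) (hε' : 0 < ε') (h1 : ε + ε' ≤ 1)
    {c c' c'' : LoopConfig E} (h : IsClose ε c c') (h' : IsClose ε' c' c'') :
    IsClose (ε + ε') c c'' := by
  -- window arithmetic: `1/(a+b) + a ≤ 1/b` when `0 < a, b` and `a + b ≤ 1`
  have key : ∀ {a b : ℝ}, 0 < a → 0 < b → a + b ≤ 1 → 1 / (a + b) + a ≤ 1 / b := by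
    intro a b ha hb hab
    rw [div_add' _ _ _ (add_pos ha hb).ne', div_le_div_iff₀ (add_pos ha hb) hb]
    nlinarith [mul_pos ha hb, mul_pos ha ha]
  have hw₁ : Metric.ball (0 : E) (1 / (ε + ε') + ε) ⊆ Metric.ball 0 (1 / ε') :=
    Metric.ball_subset_ball (key hε hε' h1)
  have hw₂ : Metric.ball (0 : E) (1 / (ε + ε') + ε') ⊆ Metric.ball 0 (1 / ε) := by
    refine Metric.ball_subset_ball ?_
    have := key hε' hε (by linarith)
    rwa [add_comm ε' ε] at this
  intro i
  refine ⟨fun u hu hr ↦ ?_, fun u'' hu'' hr ↦ ?_⟩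
  · have hball : Metric.ball (0 : E) (1 / (ε + ε')) ⊆ Metric.ball 0 (1 / ε) :=
      Metric.ball_subset_ball (one_div_le_one_div_of_le hε (by linarith))
    obtain ⟨u', hu', hd⟩ := (h i).1 u hu (hr.trans hball)
    obtain ⟨u'', hu'', hd'⟩ :=
      (h' i).1 u' hu' ((UnbasedLoop.range_subset_ball_of_udist_le hr hd).trans hw₁)
    exact ⟨u'', hu'', (UnbasedLoop.udist_triangle u u' u'').trans (add_le_add hd hd')⟩
  · have hball : Metric.ball (0 : E) (1 / (ε + ε')) ⊆ Metric.ball 0 (1 / ε') :=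
      Metric.ball_subset_ball (one_div_le_one_div_of_le hε' (by linarith))
    obtain ⟨u', hu', hd'⟩ := (h' i).2 u'' hu'' (hr.trans hball)
    obtain ⟨u, hu, hd⟩ :=
      (h i).2 u' hu' ((UnbasedLoop.range_subset_ball_of_udist_le hr hd').trans hw₂)
    refine ⟨u, hu, ?_⟩
    calc u''.udist u ≤ u''.udist u' + u'.udist u := UnbasedLoop.udist_triangle _ _ _
      _ ≤ ε' + ε := add_le_add hd' hd
      _ = ε + ε' := add_comm _ _

/-- **DKKMO's `d_CN(F, F')`** as an extended real number: the infimum of the `ε > 0` with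
`d_CN(F, F') ≤ ε` in the sense of the printed display (`IsClose`); `⊤` if there is none.
(arXiv:2012.11672v2, §1.2.) [cite: arXiv201211672v2, §1.2] -/
def cnEDist (c c' : LoopConfig E) : ℝ≥0∞ :=
  ⨅ (ε : ℝ) (_ : 0 < ε) (_ : IsClose ε c c'), ENNReal.ofReal ε

/-- `d_CN(F, F') ≤ ε` (printed sense) bounds `cnEDist`. [cite: arXiv201211672v2, §1.2] -/
theorem cnEDist_le {c c' : LoopConfig E} {ε : ℝ} (hε : 0 < ε) (h : IsClose ε c c') :
    cnEDist c c' ≤ ENNReal.ofReal ε :=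
  (iInf_le _ ε).trans <| (iInf_le _ hε).trans <| iInf_le _ h

/-- If `cnEDist F F' < ε` then `d_CN(F, F') ≤ ε` in the printed sense. [cite: arXiv201211672v2, §1.2] -/
theorem isClose_of_cnEDist_lt {c c' : LoopConfig E} {ε : ℝ}
    (h : cnEDist c c' < ENNReal.ofReal ε) : IsClose ε c c' := by
  simp only [cnEDist, iInf_lt_iff] at h
  obtain ⟨ε₀, hε₀, hc, hlt⟩ := h
  exact hc.mono hε₀ (ENNReal.ofReal_lt_ofReal_iff'.1 hlt).1.le

/-- `cnEDist` is symmetric. [cite: arXiv201211672v2, §1.2] -/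
theorem cnEDist_comm (c c' : LoopConfig E) : cnEDist c c' = cnEDist c' c := by
  simp only [cnEDist, isClose_comm (c := c)]

/-- `cnEDist F F = 0`. [folklore] -/
@[simp] theorem cnEDist_self (c : LoopConfig E) : cnEDist c c = 0 := by
  refine le_antisymm (ENNReal.le_of_forall_pos_le_add fun ε hε _ ↦ ?_) bot_le
  rw [zero_add, ← ENNReal.ofReal_coe_nnreal]
  exact cnEDist_le (by exact_mod_cast hε) (isClose_self (by exact_mod_cast hε.le) c)

/-- **Sublevel sets of `d_CN`**: for `0 ≤ r`, `cnEDist F F' ≤ r` iff `d_CN(F, F') ≤ ε` in the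
printed sense for every `ε > r` (the display defines `d_CN` through its sublevel sets, up to the
boundary case `ε = d_CN`). [cite: arXiv201211672v2, §1.2] -/
theorem cnEDist_le_iff_forall_lt {c c' : LoopConfig E} {r : ℝ} (hr : 0 ≤ r) :
    cnEDist c c' ≤ ENNReal.ofReal r ↔ ∀ ε : ℝ, r < ε → IsClose ε c c' := by
  constructor
  · intro h ε hε
    exact isClose_of_cnEDist_lt (h.trans_lt (ENNReal.ofReal_lt_ofReal_iff'.2 ⟨hε, hr.trans_lt hε⟩))
  · intro h
    refine ENNReal.le_of_forall_pos_le_add fun η hη _ ↦ ?_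
    have hη' : (0 : ℝ) < η := by exact_mod_cast hη
    rw [← ENNReal.ofReal_coe_nnreal, ← ENNReal.ofReal_add hr hη'.le]
    exact cnEDist_le (by linarith) (h _ (by linarith))

/-- Restricted triangle inequality for `cnEDist` at small scales: if `cnEDist F F' < ε`,
`cnEDist F' F'' < ε'` and `ε + ε' ≤ 1` then `cnEDist F F'' ≤ ε + ε'`. [cite: arXiv201211672v2, §1.2] -/
theorem cnEDist_le_add_of_lt {c c' c'' : LoopConfig E} {ε ε' : ℝ} (hε : 0 < ε) (hε' : 0 < ε')
    (h1 : ε + ε' ≤ 1) (h : cnEDist c c' < ENNReal.ofReal ε)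
    (h' : cnEDist c' c'' < ENNReal.ofReal ε') :
    cnEDist c c'' ≤ ENNReal.ofReal (ε + ε') :=
  cnEDist_le (add_pos hε hε') ((isClose_of_cnEDist_lt h).trans hε hε' h1 (isClose_of_cnEDist_lt h'))

/-! ### The coupling distance on laws (DKKMO eq. (2)) -/

section Law

variable {Ω Ω' : Type*} [MeasurableSpace Ω] [MeasurableSpace Ω']

/-- **DKKMO's coupling distance between the laws of two random loop configurations**
(arXiv:2012.11672v2, eq. (2)): "`d_CN(φ, φ') := inf {ε so that ∃ coupling P of φ and φ' with
P[d_CN(ω, ω') > ε] < ε}`". Here the two random configurations are `X : Ω → LoopConfig E` under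
`μ` and `X' : Ω' → LoopConfig E` under `μ'`, a coupling is a measure `P` on `Ω × Ω'` with
marginals `μ` and `μ'` (as in the paper's usage: "`ω ∼ φ_{δ𝕃(β)}` and `ω' ∼ φ_{δ𝕃(α)}` may be
coupled so that the loop representations of `ω` and `M_{β,α}⁻¹(ω')` are close", after
Theorem 1.9), and the event `d_CN(ω, ω') > ε` is the failure of the printed relation
`d_CN ≤ ε` (`¬ IsClose ε`), measured by the outer measure `P` (no σ-algebra on `C` is needed;
reading `d_CN(ω, ω') > ε` as `cnEDist > ε` instead changes the event only on `{cnEDist = ε}` and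
gives the same infimum). Values in `[0, ∞]`. [cite: arXiv201211672v2, eq. (2)] -/
def cnLawEDist (μ : Measure Ω) (X : Ω → LoopConfig E) (μ' : Measure Ω')
    (X' : Ω' → LoopConfig E) : ℝ≥0∞ :=
  ⨅ (ε : ℝ) (_ : 0 < ε) (P : Measure (Ω × Ω')) (_ : P.map Prod.fst = μ) (_ : P.map Prod.snd = μ')
    (_ : P {p | ¬ IsClose ε (X p.1) (X' p.2)} < ENNReal.ofReal ε), ENNReal.ofReal ε

variable {μ : Measure Ω} {X : Ω → LoopConfig E} {μ' : Measure Ω'} {X' : Ω' → LoopConfig E}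

/-- A coupling with `P[d_CN(ω, ω') > ε] < ε` witnesses `d_CN(φ, φ') ≤ ε`. [cite: arXiv201211672v2, eq. (2)] -/
theorem cnLawEDist_le_of_coupling {ε : ℝ} (hε : 0 < ε) (P : Measure (Ω × Ω'))
    (h₁ : P.map Prod.fst = μ) (h₂ : P.map Prod.snd = μ')
    (hP : P {p | ¬ IsClose ε (X p.1) (X' p.2)} < ENNReal.ofReal ε) :
    cnLawEDist μ X μ' X' ≤ ENNReal.ofReal ε :=
  (iInf_le _ ε).trans <| (iInf_le _ hε).trans <| (iInf_le _ P).trans <| (iInf_le _ h₁).trans <|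
    (iInf_le _ h₂).trans <| iInf_le _ hP

/-- If `d_CN(φ, φ') < ε` then there is a coupling with `P[d_CN(ω, ω') > ε] < ε` (the set of
admissible `ε` is an up-set, by `IsClose.mono`). [cite: arXiv201211672v2, eq. (2)] -/
theorem exists_coupling_of_cnLawEDist_lt {ε : ℝ} (h : cnLawEDist μ X μ' X' < ENNReal.ofReal ε) :
    ∃ P : Measure (Ω × Ω'), P.map Prod.fst = μ ∧ P.map Prod.snd = μ' ∧
      P {p | ¬ IsClose ε (X p.1) (X' p.2)} < ENNReal.ofReal ε := by
  simp only [cnLawEDist, iInf_lt_iff] at h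
  obtain ⟨ε₀, hε₀, P, h₁, h₂, hP, hlt⟩ := h
  have hle : ε₀ ≤ ε := (ENNReal.ofReal_lt_ofReal_iff'.1 hlt).1.le
  refine ⟨P, h₁, h₂, (measure_mono ?_).trans_lt (hP.trans_le (ENNReal.ofReal_le_ofReal hle))⟩
  exact fun p hp hc ↦ hp (hc.mono hε₀ hle)

/-- **Sublevel sets of the coupling distance**: for `0 ≤ r`, `d_CN(φ, φ') ≤ r` iff for every
`ε > r` there is a coupling `P` of the two laws with `P[d_CN(ω, ω') > ε] < ε`. This is the form
in which bounds `d_CN(φ_δ, φ'_δ) ≤ C δ^c` (DKKMO Theorems 1.2, 1.7, 1.9) are used. [cite: arXiv201211672v2, eq. (2)] -/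
theorem cnLawEDist_le_iff_forall_lt {r : ℝ} (hr : 0 ≤ r) :
    cnLawEDist μ X μ' X' ≤ ENNReal.ofReal r ↔
      ∀ ε : ℝ, r < ε → ∃ P : Measure (Ω × Ω'), P.map Prod.fst = μ ∧ P.map Prod.snd = μ' ∧
        P {p | ¬ IsClose ε (X p.1) (X' p.2)} < ENNReal.ofReal ε := by
  constructor
  · intro h ε hε
    exact exists_coupling_of_cnLawEDist_lt
      (h.trans_lt (ENNReal.ofReal_lt_ofReal_iff'.2 ⟨hε, hr.trans_lt hε⟩))
  · intro h
    refine ENNReal.le_of_forall_pos_le_add fun η hη _ ↦ ?_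
    have hη' : (0 : ℝ) < η := by exact_mod_cast hη
    rw [← ENNReal.ofReal_coe_nnreal, ← ENNReal.ofReal_add hr hη'.le]
    obtain ⟨P, h₁, h₂, hP⟩ := h (r + η) (by linarith)
    exact cnLawEDist_le_of_coupling (by linarith) P h₁ h₂ hP

/-- One direction of the symmetry of the coupling distance (swap the coupling). [cite: arXiv201211672v2, eq. (2)] -/
theorem cnLawEDist_comm_le (μ : Measure Ω) (X : Ω → LoopConfig E) (μ' : Measure Ω')
    (X' : Ω' → LoopConfig E) : cnLawEDist μ' X' μ X ≤ cnLawEDist μ X μ' X' := by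
  refine le_iInf fun ε ↦ le_iInf fun hε ↦ le_iInf fun P ↦ le_iInf fun h₁ ↦ le_iInf fun h₂ ↦
    le_iInf fun hP ↦ ?_
  refine cnLawEDist_le_of_coupling hε (P.map Prod.swap) ?_ ?_ ?_
  · rw [Measure.map_map measurable_fst measurable_swap]; exact h₂
  · rw [Measure.map_map measurable_snd measurable_swap]; exact h₁
  · have e : (Prod.swap : Ω × Ω' → Ω' × Ω) = (MeasurableEquiv.prodComm : Ω × Ω' ≃ᵐ Ω' × Ω) := rfl
    rw [e, MeasurableEquiv.map_apply]
    refine lt_of_le_of_lt (measure_mono ?_) hP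
    rintro ⟨a, b⟩ hp hc
    exact hp hc.symm

/-- The coupling distance is symmetric. [cite: arXiv201211672v2, eq. (2)] -/
theorem cnLawEDist_comm (μ : Measure Ω) (X : Ω → LoopConfig E) (μ' : Measure Ω')
    (X' : Ω' → LoopConfig E) : cnLawEDist μ X μ' X' = cnLawEDist μ' X' μ X :=
  le_antisymm (cnLawEDist_comm_le μ' X' μ X) (cnLawEDist_comm_le μ X μ' X')

end Law

end LoopConfig

end Literature.Probability.RandomPlanarGeometry

end
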